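import Literature.Geometry.Lorentzian.TameFamilyFarSurgery
import Literature.Geometry.Lorentzian.InitialDataPatch
import Literature.Geometry.Lorentzian.AFEndPatch
import HarnessLib

/-!
# `EIHFluxBalance.ModulatedKerrHandoff` (item stmt-FinalStateConjecture-17402): end plumbing for the
# kick ⊕ trim assembly (chart components of data agreeing pointwise; patch data)

Used by `exists_tameCurve_of_kick_trim` (file `…KickTrimAssembly.lean`) of the two trimming lines of the
crux (`Lines/trim_kick_censorship.lean`, `Lines/trim_on_the_cure.lean`):

* `hCoeff_sub_eq_of_forall`, `kCoeff_sub_eq_of_forall`, `wDist_eq_of_forall` — the weighted distance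
  `AFEnd.wDist` only sees chart-component differences, so data agreeing pointwise in the pattern
  (`D₁ = D₂ ∧ D₃ = D₄`) ∨ (`D₁ = D₃ ∧ D₂ = D₄`) have `wDist D₁ D₂ = wDist D₃ D₄`;
* `wDist_restrict_le` — the weighted distance on a collared end is at most that on the end;
* `patchData_kick_trim` — the sections of a kicked datum on an open `W ⊇ K` are patch data
  (`InitialDataSet.PatchData`) for a trimmed datum agreeing with the base datum off a far region `⊆ Wᶜ`.

Proofs carried verbatim from the strategist's skeleton `Lines/trim_kick_censorship.lean`
(planner-cstrat-stmt-FinalStateConjecture-17402-r1-0, 2026-08-17).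
-/

noncomputable section

namespace Summit.FinalStateConjecture.FinalStateConjecture.Theorems.EIHFluxBalance.TameTemplate

open scoped Topology Manifold ContDiff ENNReal
open Bundle Filter Set Function TopologicalSpace Literature.Geometry.Lorentzian InitialDataSet

-- D-0017: single-problem summit, `Summit.<S>.<S>.…` by design.
set_option linter.dupNamespace false

section End

variable {X : Type} [TopologicalSpace X] [ChartedSpace E3 X] [IsManifold (𝓡 3) ∞ X]

-- operator-norm instance paths on form-valued maps are slow to unify
set_option synthInstance.maxHeartbeats 400000 in
/-- If at EVERY point of `X` either (`D₁ = D₂` and `D₃ = D₄`) or (`D₁ = D₃` and `D₂ = D₄`) as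
metrics, then the chart-component differences `hCoeff e D₁ − hCoeff e D₂` and
`hCoeff e D₃ − hCoeff e D₄` are the same function on `E3` (junk values included). [folklore] -/
theorem hCoeff_sub_eq_of_forall (e : AFEnd X) {D₁ D₂ D₃ D₄ : InitialDataSet (𝓡 3) X}
    (h : ∀ x : X, (D₁.h.inner x = D₂.h.inner x ∧ D₃.h.inner x = D₄.h.inner x) ∨
      (D₁.h.inner x = D₃.h.inner x ∧ D₂.h.inner x = D₄.h.inner x)) :
    (fun z ↦ e.hCoeff D₁ z - e.hCoeff D₂ z) = fun z ↦ e.hCoeff D₃ z - e.hCoeff D₄ z := by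
  funext z
  by_cases hz : e.R < ‖z‖
  · have key : ∀ {A B : InitialDataSet (𝓡 3) X},
        A.h.inner (e.dataChart ⟨z, hz⟩) = B.h.inner (e.dataChart ⟨z, hz⟩) →
          e.hCoeff A z = e.hCoeff B z := fun hAB ↦ by
      simp only [AFEnd.hCoeff, dif_pos hz, pullbackBilin, hAB]
    rcases h (e.dataChart ⟨z, hz⟩) with ⟨h1, h2⟩ | ⟨h1, h2⟩
    · rw [key h1, key h2, sub_self (G := E3 →L[ℝ] E3 →L[ℝ] ℝ),
        sub_self (G := E3 →L[ℝ] E3 →L[ℝ] ℝ)]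
    · rw [key h1, key h2]
  · simp only [AFEnd.hCoeff, dif_neg hz]

-- operator-norm instance paths on form-valued maps are slow to unify
set_option synthInstance.maxHeartbeats 400000 in
/-- The same for the components of `k`. [folklore] -/
theorem kCoeff_sub_eq_of_forall (e : AFEnd X) {D₁ D₂ D₃ D₄ : InitialDataSet (𝓡 3) X}
    (h : ∀ x : X, (D₁.k x = D₂.k x ∧ D₃.k x = D₄.k x) ∨ (D₁.k x = D₃.k x ∧ D₂.k x = D₄.k x)) :
    (fun z ↦ e.kCoeff D₁ z - e.kCoeff D₂ z) = fun z ↦ e.kCoeff D₃ z - e.kCoeff D₄ z := by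
  funext z
  by_cases hz : e.R < ‖z‖
  · have key : ∀ {A B : InitialDataSet (𝓡 3) X},
        A.k (e.dataChart ⟨z, hz⟩) = B.k (e.dataChart ⟨z, hz⟩) → e.kCoeff A z = e.kCoeff B z :=
      fun hAB ↦ by
      simp only [AFEnd.kCoeff, dif_pos hz, pullbackBilin, hAB]
    rcases h (e.dataChart ⟨z, hz⟩) with ⟨h1, h2⟩ | ⟨h1, h2⟩
    · rw [key h1, key h2, sub_self (G := E3 →L[ℝ] E3 →L[ℝ] ℝ),
        sub_self (G := E3 →L[ℝ] E3 →L[ℝ] ℝ)]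
    · rw [key h1, key h2]
  · simp only [AFEnd.kCoeff, dif_neg hz]

/-- `wDist` only sees the chart-component differences: data agreeing pointwise in the pattern of
`hCoeff_sub_eq_of_forall` have the same weighted distance. [folklore] -/
theorem wDist_eq_of_forall :
    ∀ {X : Type} [TopologicalSpace X] [ChartedSpace E3 X] [IsManifold (𝓡 3) ∞ X] (e : AFEnd X) {D₁ D₂ D₃ D₄ : InitialDataSet (𝓡 3) X} (h : ∀ x : X, ((D₁.h.inner x = D₂.h.inner x ∧ D₁.k x = D₂.k x) ∧ (D₃.h.inner x = D₄.h.inner x ∧ D₃.k x = D₄.k x)) ∨ ((D₁.h.inner x = D₃.h.inner x ∧ D₁.k x = D₃.k x) ∧ (D₂.h.inner x = D₄.h.inner x ∧ D₂.k x = D₄.k x))), e.wDist D₁ D₂ = e.wDist D₃ D₄ := by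
  intro X _ _ _ e D₁ D₂ D₃ D₄ h
  have hh := hCoeff_sub_eq_of_forall e (D₁ := D₁) (D₂ := D₂) (D₃ := D₃) (D₄ := D₄) fun x ↦ by
    rcases h x with ⟨⟨a, -⟩, ⟨b, -⟩⟩ | ⟨⟨a, -⟩, ⟨b, -⟩⟩
    · exact Or.inl ⟨a, b⟩
    · exact Or.inr ⟨a, b⟩
  have hk := kCoeff_sub_eq_of_forall e (D₁ := D₁) (D₂ := D₂) (D₃ := D₃) (D₄ := D₄) fun x ↦ by
    rcases h x with ⟨⟨-, a⟩, ⟨-, b⟩⟩ | ⟨⟨-, a⟩, ⟨-, b⟩⟩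
    · exact Or.inl ⟨a, b⟩
    · exact Or.inr ⟨a, b⟩
  unfold AFEnd.wDist
  rw [hh, hk]

/-- The weighted distance on a collared end is at most that on the end (an `iSup` over a smaller
region of the same integrand, `AFEnd.wDist_restrict_eq`). [folklore] -/
theorem wDist_restrict_le (e : AFEnd X) {R₁ : ℝ} (hR₁ : e.R ≤ R₁) (D D' : InitialDataSet (𝓡 3) X) :
    (e.restrict hR₁).wDist D D' ≤ e.wDist D D' := by
  rw [e.wDist_restrict_eq hR₁]
  unfold AFEnd.wDist
  gcongr with m hm x m hm x
  · exact iSup_le fun hx ↦ le_iSup_of_le (lt_of_le_of_lt hR₁ hx) le_rfl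
  · exact iSup_le fun hx ↦ le_iSup_of_le (lt_of_le_of_lt hR₁ hx) le_rfl

end End

section Patch

variable {X : Type} [TopologicalSpace X] [ChartedSpace E3 X] [IsManifold (𝓡 3) ∞ X] [T2Space X]

/-- **Patch data: the kicked core inside a trimmed datum.** For a datum `T` having the sections of
`d` off a far region contained in `Wᶜ = closedFar Rb`, an open `W ⊇ K`, and a datum `Gc` having
the sections of `d` off the compact `K`, the sections of `Gc` on `W` are patch data for `T`
(`W ∖ K`: both are `d`). [cite: Corvino2000, §4] -/
theorem patchData_kick_trim (e : AFEnd X) {d T Gc : InitialDataSet (𝓡 3) X} {K : Set X}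
    {Rb R : ℝ} (hRb : e.R < Rb) (hR : Rb ≤ R) (hK : IsCompact K)
    (hKW : K ⊆ (e.closedFar Rb)ᶜ)
    (hT : ∀ x ∉ e.far R, T.h.inner x = d.h.inner x ∧ T.k x = d.k x)
    (hG : ∀ x ∉ K, Gc.h.inner x = d.h.inner x ∧ Gc.k x = d.k x) :
    T.PatchData (e.closedFar Rb)ᶜ K Gc.h.inner Gc.k where
  isOpen := (e.isClosed_closedFar hRb).isOpen_compl
  isClosed := hK.isClosed
  subset := hKW
  smooth_h := Gc.h.contMDiff.contMDiffOn
  smooth_k := Gc.contMDiff_k.contMDiffOn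
  symm_h := fun x _ v w ↦ Gc.h.symm x v w
  pos_h := fun x _ v hv ↦ Gc.h.pos x v hv
  symm_k := fun x _ v w ↦ Gc.k_symm x v w
  agree_h := fun x hxW hxK ↦ by
    have hxfar : x ∉ e.far R := fun hx ↦ hxW ((e.far_mono hR).trans (e.far_subset_closedFar Rb) hx)
    rw [(hG x hxK).1, (hT x hxfar).1]
  agree_k := fun x hxW hxK ↦ by
    have hxfar : x ∉ e.far R := fun hx ↦ hxW ((e.far_mono hR).trans (e.far_subset_closedFar Rb) hx)
    rw [(hG x hxK).2, (hT x hxfar).2]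

end Patch

end Summit.FinalStateConjecture.FinalStateConjecture.Theorems.EIHFluxBalance.TameTemplate

end
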